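import Summits.QuantumFields.BalabanUV.T4Continuum.Support.RegionElectricSplitting
import Summits.QuantumFields.BalabanUV.T4Continuum.Support.AlignedCarrierTrace
import Summits.QuantumFields.BalabanUV.T4Continuum.Support.DirichletStarVectorTower
import Summits.QuantumFields.BalabanUV.Beta.GAN24.DirichletBoxRegularity

/-!
# T⁴ programme, spine node NE2 (U1a), sub-row Δ1 «NE2⁰-Dirichlet» — THE STAR-BOND FIELDS READ COMPONENT BY COMPONENT: the electric
# operator `Σ_μ W_μ` and King's compressed planting `JpR` as SCALAR torus operators on the zero-extended components (file P4a of (P-gaffney))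

NE2 formalisation swarm `b2b-balaban-t4-ne2-formalise-*`, LEAF PROVER 01 (gen 10), supplier file for leaf-03-g8's item «W3-GAFFNEY-PAIRING»
= (P-gaffney) for the LOCAL operator (owner rulings R35 (c) / R36 (c), journal `CLAIMS.log` 2026-08-20 l.22128 / l.22328; leaf-03-g8's
file plan l.22258, «TAKE P4» l.22541): P4 = the FIRST-ORDER IDENTITY joining the owner's (P-W) currency `star v ⬝ᵥ ((JpR·W − W′·JpR) u)`
(`W = Σ_μ Wdir μ`, leaf-02-g8 `RegionElectricSplitting.electric_splitting`) to gan24-p2-g22's scalar torus pairings `⟨(A_μ − F_μ)z′, ∂_μ z⟩`.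
THIS FILE (P4a) is the dictionary between the star-bond world `V = {b // starReg n M S b}` and the scalar torus world, per component:

 * §1 `zext ν u := ext (starSite ν) (component ν of u)` — the zero-extended component; **`star_dotProduct_eq_sum_zext`**: a dot product
   over the star bonds is the sum over `ν` of the torus dot products of the components.
 * §2 **`Wdir_mulVec_apply_of_ne`** (ANY region): on a star bond `(x, ν)`, `μ ≠ ν`, `(W_μ u)(x,ν) = (P_μ z_ν)(x)` — the transverse
   directional operator IS the Dirichlet second difference `P_μ = ∂_μᴴ∂_μ` of the zero-extended component (leaf-02-g8's `toBlock_fdiff_sq`);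
   **`Wdir_mulVec_apply_self`** (H1 = `AtMostOneNeighbour`): `(W_ν u)(x,ν) = (∂_νᴴ·diag χ_ν·∂_ν z_ν)(x)`, `χ_ν(y) = 𝟙[y + e_ν ∈ Ω]` — the
   own-direction operator is the NEUMANN second difference with the bond mask `χ_ν` (`cnt1_own_eq`, `not_star_add_iff`, `not_star_sub_iff`).
 * §3 THE PLANTING: `JKs N R M S := (JK N R M).toBlock T′ T` (= the tower's `JpR`, `JpR_eq_JKs`, rfl), **`JKs_mulVec_apply`** `(J u)(x′,ν) = (J₀ z_ν)(x′)` and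
   **`JKs_conjTranspose_mulVec_apply`** `(Jᴴ v)(y,ν) = (J₀ᴴ z′_ν)(y)` (`J₀ = JK0 N R M`, King's scalar planting); the two VANISHING facts that kill every wall term:
   **`JK0_conjTranspose_zext_apply_of_not`** — `(J₀ᴴ z′_ν)(y) = 0` off the coarse carrier (downward closure `star_par`), and
   **`Pneu_zext_apply_of_not`** (own direction, any region: off the carrier both incident bonds carry the mask `χ = 0`).  The transverse
   companion (product regions) and the assembled «no wall term» statement are in file P4b (`Support/StarCarrierTwoLevelIdentity`).

HONEST FRAMING (T4-DAG p. 1).  [folklore] finite lattice bookkeeping on the tree's typed objects; nothing printed is a hypothesis or a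
conclusion; no NE2 statement is proved here (input of (P-gaffney) ⊂ leaf (L) of the owner's `hinjK_of_local`); (P-gaffney) / (L) / `hinjK` /
W3 on boxes OPEN; NE2 (U1a) NOT proved; spine PROVED 0/9 unchanged; NOT [B9] (3.16)/(3.23)–(3.27) as printed; NOT infinite volume, NOT a
mass gap, NOT the Clay problem.  HONEST DEPENDENCY: continuum YM on T⁴ ⇐ BetaPertH ∧ nine spine estimates (0/9 proved); BetaPertH ⇐ (D1) ∧
(D4) ∧ CAP+tail; G-an2-4 gates asym, D1 and NE2/3/4.  No `sorry`.
-/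

noncomputable section

open scoped BigOperators ComplexConjugate Matrix Matrix.Norms.L2Operator
open Finset

namespace Summit.QuantumFields.BalabanUV.T4Continuum.StarCarrierComponents

open Literature.MathematicalPhysics.QuantumFieldTheory.Balaban1983to89.B5Prop11Plancherel (Tor fine fdiff unitVec)
open Literature.MathematicalPhysics.QuantumFieldTheory.Balaban1983to89.B5Prop11Lower (nsq)
open Literature.MathematicalPhysics.QuantumFieldTheory.Balaban1983to89.B5Action121 (sdiff sdiff_mulVec sdiff_conjTranspose_mulVec)
open Literature.MathematicalPhysics.QuantumFieldTheory.Balaban1983to89.B5G183FreeRowSum (fdiff_mulVec fdiff_conjTranspose_mulVec)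
open Literature.MathematicalPhysics.QuantumFieldTheory.Balaban1983to89.B5G183RateUnitTower (lev)
open Literature.MathematicalPhysics.QuantumFieldTheory.Balaban1983to89.B5Blocks16 (blockOf)
open Summit.QuantumFields.BalabanUV.T4Continuum
open Summit.QuantumFields.BalabanUV.T4Continuum.SubtypeCompression (ext ext_apply_of ext_apply_of_not toBlock_conjTranspose)
open Summit.QuantumFields.BalabanUV.T4Continuum.BalabanAveragedTowerModes (par)
open Summit.QuantumFields.BalabanUV.T4Continuum.BlockPairingGeometry (parT par_add_unitVec)
open Summit.QuantumFields.BalabanUV.T4Continuum.KingPairingPlantedLaw (JK JpcT JpcT_eq_JK)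
open Summit.QuantumFields.BalabanUV.T4Continuum.BlockPairingGeometry (JK_apply)
open Summit.QuantumFields.BalabanUV.T4Continuum.ScalarBlockPlanting (Qavg0 JK0 star_Qavg0_apply)
open Summit.QuantumFields.BalabanUV.T4Continuum.ScalarPlantingDefect (blockOf_par)
open Summit.QuantumFields.BalabanUV.T4Continuum.DirichletSubregionTowerOf (pidx JpR)
open Summit.QuantumFields.BalabanUV.T4Continuum.RegionGaugeFixedVector (starReg)
open Summit.QuantumFields.BalabanUV.T4Continuum.DirichletStarVectorTower (starP)
open Summit.QuantumFields.BalabanUV.T4Continuum.RegionStarBoundaryCharges (AtMostOneNeighbour blockOf_add_unitVec_apply_of_ne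
  blockOf_sub_unitVec_apply_of_ne atMostOneNeighbour_of_isCoordBox)
open Summit.QuantumFields.BalabanUV.T4Continuum.RegionElectricSplitting (Wdir cnt1 tcnt toBlock_fdiff_sq cnt1_own_eq not_star_add_iff
  not_star_sub_iff)
open Summit.QuantumFields.BalabanUV.T4Continuum.AlignedCarrierTrace (starSite starSite_iff)
open Summit.QuantumFields.BalabanUV.Beta.GAN24.DirichletBoxCompression (toBlock_mulVec')
open Summit.QuantumFields.BalabanUV.Beta.GAN24.DirichletBoxTrace (blockReg)
open Summit.QuantumFields.BalabanUV.Beta.GAN24.DirichletBoxTwoLevelCore (refineR_blockReg_iff)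
open Summit.QuantumFields.BalabanUV.Beta.GAN24.DirichletBoxRegularity (Pdir Pdir_mulVec)
open Summit.QuantumFields.BalabanUV.Beta.GAN24.DirichletBoxTwoLevel (IsCoordBox)

variable {d : ℕ}

/-! ## §1 Components of a star-bond field and their zero extensions -/

section Components

variable (n : ℕ) [NeZero n] (M : Fin d → ℕ) [hM : ∀ μ, NeZero (M μ)] (S : Tor M → Prop) [DecidablePred S]

/-- component `ν` of a star-bond field, as a function on the star SITES of component `ν`. [folklore] -/
def comp (ν : Fin d) (u : {b // starReg n M S b} → ℂ) : {x // starSite n M S ν x} → ℂ := fun x => u ⟨(x.1, ν), x.2⟩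

/-- THE ZERO-EXTENDED COMPONENT `z_ν = ι(u_ν)` on the torus. [folklore] -/
def zext (ν : Fin d) (u : {b // starReg n M S b} → ℂ) : Tor (fine n M) → ℂ := ext (starSite n M S ν) (comp n M S ν u)

/-- on a star site the zero extension is the field. [folklore] -/
theorem zext_apply_of (ν : Fin d) (u : {b // starReg n M S b} → ℂ) {x : Tor (fine n M)} (h : starReg n M S (x, ν)) :
    zext n M S ν u x = u ⟨(x, ν), h⟩ := by
  unfold zext comp
  rw [ext_apply_of (starSite n M S ν) _ ⟨x, h⟩]

/-- off the star sites the zero extension vanishes. [folklore] -/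
theorem zext_apply_of_not (ν : Fin d) (u : {b // starReg n M S b} → ℂ) {x : Tor (fine n M)} (h : ¬ starReg n M S (x, ν)) :
    zext n M S ν u x = 0 :=
  ext_apply_of_not (starSite n M S ν) _ (show ¬ starSite n M S ν x from h)

/-- the zero extension over ALL star bonds, read at `(x, ν)`, is the zero-extended component `ν` at `x`. [folklore] -/
theorem ext_star_apply (u : {b // starReg n M S b} → ℂ) (x : Tor (fine n M)) (ν : Fin d) :
    ext (starReg n M S) u (x, ν) = zext n M S ν u x := by
  by_cases h : starReg n M S (x, ν)
  · rw [ext_apply_of (starReg n M S) u ⟨(x, ν), h⟩, zext_apply_of n M S ν u h]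
  · rw [ext_apply_of_not (starReg n M S) u h, zext_apply_of_not n M S ν u h]

/-- **A DOT PRODUCT OVER THE STAR BONDS IS THE SUM OVER COMPONENTS OF THE TORUS DOT PRODUCTS OF THE ZERO-EXTENDED COMPONENTS.**
[folklore] -/
theorem star_dotProduct_eq_sum_zext (a b : {b // starReg n M S b} → ℂ) :
    star a ⬝ᵥ b = ∑ ν, star (zext n M S ν a) ⬝ᵥ zext n M S ν b := by
  -- both sides are `Σ_{(x,ν)} conj(ι a (x,ν))·ι b (x,ν)`
  have h1 : star a ⬝ᵥ b = ∑ c : Tor (fine n M) × Fin d, star (ext (starReg n M S) a c) * ext (starReg n M S) b c := by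
    unfold dotProduct
    rw [← Fintype.sum_subtype_add_sum_subtype (starReg n M S) (fun c => star (ext (starReg n M S) a c) * ext (starReg n M S) b c)]
    have h0 : ∑ c : {c // ¬ starReg n M S c}, star (ext (starReg n M S) a c) * ext (starReg n M S) b c = 0 :=
      sum_eq_zero fun c _ => by rw [ext_apply_of_not (starReg n M S) b c.2, mul_zero]
    rw [h0, add_zero]
    exact sum_congr rfl fun c _ => by rw [Pi.star_apply, ext_apply_of, ext_apply_of]
  rw [h1, Fintype.sum_prod_type, sum_comm]
  refine sum_congr rfl fun ν _ => ?_
  unfold dotProduct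
  exact sum_congr rfl fun x _ => by rw [Pi.star_apply, ext_star_apply, ext_star_apply]

end Components

/-! ## §2 The directional operators read on the components -/

section Directional

variable (n : ℕ) [NeZero n] (M : Fin d → ℕ) [hM : ∀ μ, NeZero (M μ)] (S : Tor M → Prop) [DecidablePred S]

/-- THE NEUMANN BOND MASK of component `ν`: `χ_ν(y) = 𝟙[y + e_ν ∈ Ω]` (the coarse `ν`-bond `(y, y + e_ν)` is kept iff its head is in `Ω`).
[folklore] -/
def chi (ν : Fin d) (y : Tor (fine n M)) : ℂ := if blockReg n M S (y + unitVec (fine n M) ν) then 1 else 0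

/-- THE MASKED (NEUMANN) SECOND DIFFERENCE in direction `ν`: `∂_νᴴ·diag(χ_ν)·∂_ν`. [folklore] -/
def Pneu (ν : Fin d) : Matrix (Tor (fine n M)) (Tor (fine n M)) ℂ :=
  (sdiff (fine n M) (n : ℂ) ν)ᴴ * Matrix.diagonal (chi n M S ν) * sdiff (fine n M) (n : ℂ) ν

/-- the stencil of the masked second difference:
`(Pneu_ν z)(x) = n²·(χ_ν(x − e_ν)·(z(x) − z(x − e_ν)) − χ_ν(x)·(z(x + e_ν) − z(x)))`. [folklore] -/
theorem Pneu_mulVec (ν : Fin d) (z : Tor (fine n M) → ℂ) (x : Tor (fine n M)) :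
    (Pneu n M S ν *ᵥ z) x
      = (n : ℂ) * (n : ℂ) * (chi n M S ν (x - unitVec (fine n M) ν) * (z x - z (x - unitVec (fine n M) ν))
          - chi n M S ν x * (z (x + unitVec (fine n M) ν) - z x)) := by
  unfold Pneu
  rw [← Matrix.mulVec_mulVec, ← Matrix.mulVec_mulVec, sdiff_conjTranspose_mulVec, Matrix.mulVec_diagonal, Matrix.mulVec_diagonal,
    sdiff_mulVec, sdiff_mulVec, sub_add_cancel, Complex.conj_natCast]
  ring

/-- THE DIRECTIONAL SCALAR OPERATOR of the pair (direction `μ`, component `ν`): Dirichlet `P_μ` transverse, masked Neumann in the own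
direction. [folklore] -/
def Lam (μ ν : Fin d) : Matrix (Tor (fine n M)) (Tor (fine n M)) ℂ := if μ = ν then Pneu n M S ν else Pdir (fine n M) (n : ℂ) μ

/-- the vector one-direction Laplacian acts componentwise as `P_μ`: `((∇_μ)ᴴ∇_μ A)(x,ν) = (P_μ A(·,ν))(x)`. [folklore] -/
theorem fdiff_sq_mulVec_apply (μ : Fin d) (A : Tor (fine n M) × Fin d → ℂ) (x : Tor (fine n M)) (ν : Fin d) :
    (((fdiff (fine n M) (n : ℂ) μ)ᴴ * fdiff (fine n M) (n : ℂ) μ) *ᵥ A) (x, ν) = (Pdir (fine n M) (n : ℂ) μ *ᵥ fun y => A (y, ν)) x := by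
  rw [← Matrix.mulVec_mulVec, fdiff_conjTranspose_mulVec, fdiff_mulVec, fdiff_mulVec, Pdir_mulVec, sub_add_cancel, Complex.conj_natCast]
  ring

/-- `W_μ` read at a star bond: `(W_μ u)(x,ν) = (P_μ z_ν)(x) − n²·[ν = μ]·cnt1 μ (x,ν)·u(x,ν)` (ANY region; `toBlock_fdiff_sq`). [folklore] -/
theorem Wdir_mulVec_apply (μ : Fin d) (u : {b // starReg n M S b} → ℂ) (b : {b // starReg n M S b}) :
    (Wdir n M S μ *ᵥ u) b
      = (Pdir (fine n M) (n : ℂ) μ *ᵥ zext n M S b.1.2 u) b.1.1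
        - (((n : ℝ) ^ 2 * (if b.1.2 = μ then cnt1 n M S μ b.1 else 0) : ℝ) : ℂ) * u b := by
  -- `Wdir μ = ((∇_μ)ᴴ∇_μ)_{VV} + diag(n²(tcnt − cnt1))`
  have hW : Wdir n M S μ = ((fdiff (fine n M) (n : ℂ) μ)ᴴ * fdiff (fine n M) (n : ℂ) μ).toBlock (starReg n M S) (starReg n M S)
      + Matrix.diagonal (fun b : {b // starReg n M S b} => (((n : ℝ) ^ 2 * (tcnt n M S μ b.1 - cnt1 n M S μ b.1) : ℝ) : ℂ)) := by
    rw [toBlock_fdiff_sq, Wdir, add_assoc, Matrix.diagonal_add]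
    congr 1
    refine congrArg Matrix.diagonal (funext fun b => ?_)
    push_cast; ring
  rw [hW, Matrix.add_mulVec, Pi.add_apply, toBlock_mulVec', Matrix.mulVec_diagonal]
  obtain ⟨⟨x, ν⟩, hb⟩ := b
  dsimp only
  rw [fdiff_sq_mulVec_apply]
  have hz : (fun y => ext (starReg n M S) u (y, ν)) = zext n M S ν u := funext fun y => ext_star_apply n M S u y ν
  rw [hz]
  unfold tcnt
  dsimp only
  by_cases h : ν = μ
  · rw [if_pos h, if_pos h]; push_cast; ring
  · rw [if_neg h, if_neg h]; push_cast; ring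

/-- **TRANSVERSE DIRECTIONS (ANY region)**: on a star bond `(x,ν)` with `μ ≠ ν`, `(W_μ u)(x,ν) = (P_μ z_ν)(x)`. [folklore] -/
theorem Wdir_mulVec_apply_of_ne {μ ν : Fin d} (hμν : μ ≠ ν) (u : {b // starReg n M S b} → ℂ) {x : Tor (fine n M)}
    (h : starReg n M S (x, ν)) :
    (Wdir n M S μ *ᵥ u) ⟨(x, ν), h⟩ = (Pdir (fine n M) (n : ℂ) μ *ᵥ zext n M S ν u) x := by
  rw [Wdir_mulVec_apply]
  simp only [if_neg hμν.symm, mul_zero, Complex.ofReal_zero, zero_mul, sub_zero]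

/-- **OWN DIRECTION (H1)**: on a star bond `(x,ν)`, `(W_ν u)(x,ν) = (∂_νᴴ·diag χ_ν·∂_ν z_ν)(x)` — the Neumann second difference.
[folklore] -/
theorem Wdir_mulVec_apply_self (hH : AtMostOneNeighbour n M S) (ν : Fin d) (u : {b // starReg n M S b} → ℂ) {x : Tor (fine n M)}
    (h : starReg n M S (x, ν)) :
    (Wdir n M S ν *ᵥ u) ⟨(x, ν), h⟩ = (Pneu n M S ν *ᵥ zext n M S ν u) x := by
  rw [Wdir_mulVec_apply, Pdir_mulVec, Pneu_mulVec, Complex.conj_natCast]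
  simp only [if_true]
  rw [cnt1_own_eq n M S hH ⟨(x, ν), h⟩]
  dsimp only
  -- the four values of `z_ν` around `x`, under H1
  have hz0 : zext n M S ν u x = u ⟨(x, ν), h⟩ := zext_apply_of n M S ν u h
  have hadd := not_star_add_iff n M S hH ⟨(x, ν), h⟩
  have hsub := not_star_sub_iff n M S hH ⟨(x, ν), h⟩
  simp only at hadd hsub
  -- `χ(x) = [x + e ∈ Ω]`, `χ(x − e) = [x ∈ Ω]`
  have hchi1 : chi n M S ν x = if blockReg n M S (x + unitVec (fine n M) ν) then 1 else 0 := rfl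
  have hchi2 : chi n M S ν (x - unitVec (fine n M) ν) = if blockReg n M S x then 1 else 0 := by
    unfold chi; rw [sub_add_cancel]
  rw [hchi1, hchi2, hz0]
  by_cases hp : blockReg n M S (x + unitVec (fine n M) ν) <;> by_cases hm : blockReg n M S x
  · -- interior: both neighbours are star bonds
    have hp' : starReg n M S (x + unitVec (fine n M) ν, ν) := not_not.mp (mt hadd.mp (not_not.mpr hp))
    have hm' : starReg n M S (x - unitVec (fine n M) ν, ν) := not_not.mp (mt hsub.mp (not_not.mpr hm))
    rw [if_pos hp, if_pos hm, if_pos hp, if_pos hm, zext_apply_of n M S ν u hp', zext_apply_of n M S ν u hm']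
    push_cast; ring
  · -- head in, tail out: `x ∉ Ω` so `x − e` is not a star bond
    have hp' : starReg n M S (x + unitVec (fine n M) ν, ν) := not_not.mp (mt hadd.mp (not_not.mpr hp))
    have hm' : ¬ starReg n M S (x - unitVec (fine n M) ν, ν) := hsub.mpr hm
    rw [if_pos hp, if_neg hm, if_pos hp, if_neg hm, zext_apply_of n M S ν u hp', zext_apply_of_not n M S ν u hm']
    push_cast; ring
  · have hp' : ¬ starReg n M S (x + unitVec (fine n M) ν, ν) := hadd.mpr hp
    have hm' : starReg n M S (x - unitVec (fine n M) ν, ν) := not_not.mp (mt hsub.mp (not_not.mpr hm))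
    rw [if_neg hp, if_pos hm, if_neg hp, if_pos hm, zext_apply_of_not n M S ν u hp', zext_apply_of n M S ν u hm']
    push_cast; ring
  · have hp' : ¬ starReg n M S (x + unitVec (fine n M) ν, ν) := hadd.mpr hp
    have hm' : ¬ starReg n M S (x - unitVec (fine n M) ν, ν) := hsub.mpr hm
    rw [if_neg hp, if_neg hm, if_neg hp, if_neg hm, zext_apply_of_not n M S ν u hp', zext_apply_of_not n M S ν u hm']
    push_cast; ring

/-- **BOTH CASES AT ONCE (H1)**: `(W_μ u)(x,ν) = (Λ^{μ,ν} z_ν)(x)`. [folklore] -/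
theorem Wdir_mulVec_apply_eq_Lam (hH : AtMostOneNeighbour n M S) (μ ν : Fin d) (u : {b // starReg n M S b} → ℂ) {x : Tor (fine n M)}
    (h : starReg n M S (x, ν)) :
    (Wdir n M S μ *ᵥ u) ⟨(x, ν), h⟩ = (Lam n M S μ ν *ᵥ zext n M S ν u) x := by
  unfold Lam
  by_cases hμν : μ = ν
  · subst hμν; rw [if_pos rfl, Wdir_mulVec_apply_self n M S hH]
  · rw [if_neg hμν, Wdir_mulVec_apply_of_ne n M S hμν]

/-- **OWN DIRECTION, OFF THE CARRIER**: `(Pneu_ν z_ν)(x) = 0` whenever `(x, ν)` is NOT a star bond — both incident `ν`-bonds carry the mask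
`0` (ANY region, no H1). [folklore] -/
theorem Pneu_zext_apply_of_not (ν : Fin d) (u : {b // starReg n M S b} → ℂ) {x : Tor (fine n M)} (h : ¬ starReg n M S (x, ν)) :
    (Pneu n M S ν *ᵥ zext n M S ν u) x = 0 := by
  rw [Pneu_mulVec, zext_apply_of_not n M S ν u h]
  -- `χ(x) = [x + e ∈ Ω] = 0` (else `(x,ν)` would be a star bond) and `χ(x − e) = [x ∈ Ω] = 0`
  have h1 : chi n M S ν x = 0 := by
    unfold chi; rw [if_neg]; exact fun hx => h (Or.inr hx)
  have h2 : chi n M S ν (x - unitVec (fine n M) ν) = 0 := by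
    unfold chi; rw [sub_add_cancel, if_neg]; exact fun hx => h (Or.inl hx)
  rw [h1, h2]; ring

end Directional

/-! ## §3 King's compressed planting read on the components; the two vanishing facts -/

section Planting

variable (N R : ℕ) [NeZero N] [NeZero R] (M : Fin d → ℕ) [hM : ∀ μ, NeZero (M μ)] (S : Tor M → Prop) [DecidablePred S]

/-- the entries of King's VECTOR planting are those of the SCALAR planting, component by component. [folklore] -/
theorem JK_apply_eq (x' : Tor (fine (R * N) M)) (ν' : Fin d) (y : Tor (fine N M)) (ν : Fin d) :
    JK N R M (x', ν') (y, ν) = if ν' = ν then JK0 N R M x' y else 0 := by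
  rw [JK_apply, JK0, Matrix.smul_apply, Matrix.conjTranspose_apply, star_Qavg0_apply, smul_eq_mul]
  unfold Qavg0 parT
  by_cases hν : ν' = ν
  · subst hν
    by_cases hp : par N R M x' = y
    · rw [if_pos (by rw [hp]), if_pos rfl, if_pos hp, mul_one]
    · rw [if_neg (fun h => hp (by simpa using congrArg Prod.fst h)), if_pos rfl, if_neg hp, mul_zero, mul_zero]
  · rw [if_neg (fun h => hν (by simpa using congrArg Prod.snd h)), if_neg hν, mul_zero, mul_zero]

/-- KING's VECTOR PLANTING COMPRESSED TO THE STAR BONDS of the two levels (`= DirichletSubregionTowerOf.JpR` along the tower, by `rfl`).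
[folklore] -/
abbrev JKs : Matrix {b // starReg (R * N) M S b} {b // starReg N M S b} ℂ := (JK N R M).toBlock (starReg (R * N) M S) (starReg N M S)

/-- **THE COMPRESSED PLANTING READ ON COMPONENTS**: `(J u)(x′,ν) = (J₀ z_ν)(x′)`, `J₀ = JK0 N R M` the scalar planting. [folklore] -/
theorem JKs_mulVec_apply (u : {b // starReg N M S b} → ℂ) {x' : Tor (fine (R * N) M)} {ν : Fin d} (h' : starReg (R * N) M S (x', ν)) :
    (JKs N R M S *ᵥ u) ⟨(x', ν), h'⟩ = (JK0 N R M *ᵥ zext N M S ν u) x' := by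
  unfold JKs
  rw [toBlock_mulVec']
  dsimp only
  simp only [Matrix.mulVec, dotProduct]
  rw [Fintype.sum_prod_type]
  refine sum_congr rfl fun y _ => ?_
  simp only [JK_apply_eq, ite_mul, zero_mul, Finset.sum_ite_eq, Finset.mem_univ, if_true]
  rw [ext_star_apply]

/-- **ITS ADJOINT READ ON COMPONENTS**: `(Jᴴ v)(y,ν) = (J₀ᴴ z′_ν)(y)`. [folklore] -/
theorem JKs_conjTranspose_mulVec_apply (v : {b // starReg (R * N) M S b} → ℂ) {y : Tor (fine N M)} {ν : Fin d}
    (h : starReg N M S (y, ν)) :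
    ((JKs N R M S)ᴴ *ᵥ v) ⟨(y, ν), h⟩ = ((JK0 N R M)ᴴ *ᵥ zext (R * N) M S ν v) y := by
  unfold JKs
  rw [toBlock_conjTranspose, toBlock_mulVec']
  dsimp only
  simp only [Matrix.mulVec, dotProduct, Matrix.conjTranspose_apply]
  rw [Fintype.sum_prod_type]
  refine sum_congr rfl fun x' _ => ?_
  simp only [JK_apply_eq, apply_ite star, star_zero, ite_mul, zero_mul, Finset.sum_ite_eq', Finset.mem_univ, if_true]
  rw [ext_star_apply]

omit [DecidablePred S] in
/-- DOWNWARD CLOSURE (two levels): a fine star bond has a star parent. [folklore] -/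
theorem star_par {x' : Tor (fine (R * N) M)} {ν : Fin d} (h : starReg (R * N) M S (x', ν)) : starReg N M S (par N R M x', ν) := by
  rcases h with h1 | h2
  · exact Or.inl ((refineR_blockReg_iff N R M S x').mpr h1)
  · have h3 : blockReg N M S (par N R M (x' + unitVec (fine (R * N) M) ν)) := (refineR_blockReg_iff N R M S _).mpr h2
    have h4 := par_add_unitVec N R M ν x'
    by_cases hdiv : R ∣ (x' ν).val + 1
    · rw [if_pos hdiv] at h4
      right
      show blockReg N M S (par N R M x' + unitVec (fine N M) ν)
      rw [← h4]; exact h3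
    · rw [if_neg hdiv] at h4
      left
      show blockReg N M S (par N R M x')
      rw [← h4]; exact h3

/-- **VANISHING 1**: `(J₀ᴴ z′_ν)(y) = 0` when `(y, ν)` is NOT a coarse star bond (every fine star bond has a star parent). [folklore] -/
theorem JK0_conjTranspose_zext_apply_of_not (v : {b // starReg (R * N) M S b} → ℂ) {y : Tor (fine N M)} {ν : Fin d}
    (h : ¬ starReg N M S (y, ν)) :
    ((JK0 N R M)ᴴ *ᵥ zext (R * N) M S ν v) y = 0 := by
  simp only [Matrix.mulVec, dotProduct, Matrix.conjTranspose_apply]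
  refine sum_eq_zero fun x' _ => ?_
  by_cases hx : starReg (R * N) M S (x', ν)
  · -- a star child: its parent is a star bond, so `par x′ ≠ y`, and the planting entry vanishes
    have hpar : par N R M x' ≠ y := by
      intro hp
      have := star_par N R M S hx
      rw [hp] at this
      exact h this
    rw [JK0, Matrix.smul_apply, Matrix.conjTranspose_apply, star_Qavg0_apply]
    unfold Qavg0
    rw [if_neg hpar, smul_zero, star_zero, zero_mul]
  · rw [zext_apply_of_not _ M S ν v hx, mul_zero]

/-- hence, as functions: the zero-extended component of `Jᴴv` IS `J₀ᴴ z′_ν` (on the carrier by §3, off it both vanish). [folklore] -/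
theorem zext_JKs_conjTranspose_mulVec (v : {b // starReg (R * N) M S b} → ℂ) (ν : Fin d) :
    zext N M S ν ((JKs N R M S)ᴴ *ᵥ v) = (JK0 N R M)ᴴ *ᵥ zext (R * N) M S ν v := by
  funext y
  by_cases h : starReg N M S (y, ν)
  · rw [zext_apply_of N M S ν _ h, JKs_conjTranspose_mulVec_apply]
  · rw [zext_apply_of_not N M S ν _ h, JK0_conjTranspose_zext_apply_of_not N R M S v h]

omit [DecidablePred S] in
/-- the tower's compressed planting IS `JKs` (definitional): `JpR L M (starP L M S) k = JKs (lev L k) L M S`. [folklore] -/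
theorem JpR_eq_JKs (L : ℕ) [NeZero L] (k : ℕ) : JpR L M (starP L M S) k = JKs (lev L k) L M S := rfl

end Planting

end Summit.QuantumFields.BalabanUV.T4Continuum.StarCarrierComponents

end
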